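import Summits.Ventures.PercRepro.GenQEmptyClassTen
import Summits.Ventures.PercRepro.Night4LT6C10Q7M0H15L1Z
import Summits.Ventures.PercRepro.Night4LT6C10Q7M0H14E0H15E2Z
import Summits.Ventures.PercRepro.Night4LT6C10Q7M0H14E1H15E2Z
import Summits.Ventures.PercRepro.Night4LT6C10Q7M0H14E0H15E3Z

/-!
# PercRepro — the type-`6` layer at `q = 7` on the core, corank `10`, `m(G) = 0`: the UNCONDITIONAL theorem
(night-4 gen 13)

The two-level profile LP on the Lean-backed rows is negative at corank `10` unsplit (`−5,346.66`, sheet §65 (d))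
and positive on every class of the integer split on the top trace counts `(h₁₅, h₁₄)`: the four class theorems
`jq_t6_nonneg_c10_q7_m0_two_level_h15le1` (`h₁₅ ≤ 1`, `+8,602.19`), `…_h14_0_h15_2` (`+15,890.68`),
`…_h14_1_h15_2` (`+10,299.67`) and `…_h14_0_h15_3` (`+18,302.38`, on the row (GS0c)).  The case split is closed by
`GenQEmptyClassTen`: `h₁₅ ≤ 3` (the pencil cap), `h₁₅ = 2 ⇒ h₁₄ ≤ 1` and `h₁₅ = 3 ⇒ h₁₄ = 0` (the empty classes).
So `jq_t6_nonneg_c10_q7_m0_two_level` holds with NO branch hypothesis — the fifth unconditional case of the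
two-level LP in the kernel (after type `5` at coranks `9`, `10`, `11` and type `6` at corank `9`).
-/
namespace PercRepro.Night4

open Finset ThmH SixFour GenQ PerFlat Star

variable {α : Type*} [DecidableEq α] {M : Matroid α} [M.Finite]

/-- **the type-`6` layer at `q = 7` on the core, corank `10`, `m(G) = 0`** — THE TWO-LEVEL PROFILE LP ON
TREE-THEOREM ROWS, no branch hypothesis: the integer split on `(h₁₅, h₁₄)` with its four class certificates and the
empty-class lemmas of `GenQEmptyClassTen` (night-4 gen 13). -/
theorem jq_t6_nonneg_c10_q7_m0_two_level (hs : Simple M) (hline : ∀ L ∈ flatsQ M 2, L.card ≤ 3)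
    (hplane : ∀ P ∈ flatsQ M 3, P.card ≤ 6) (hsolid : ∀ F ∈ flatsQ M 4, F.card ≤ 10)
    (hflat5 : ∀ F ∈ flatsQ M 5, F.card ≤ 21) (hflat6 : ∀ F ∈ flatsQ M 6, F.card ≤ 43) {G : Finset α}
    (hG : G ⊆ gr M) (hrG : M.eRk (G : Set α) = ((7 : ℕ) : ℕ∞)) (hcard : G.card = 7 + 10) (hmG : mTr M G = 0) :
    0 ≤ Jq M G 7 6 := by
  have hcard17 : G.card = 17 := hcard
  have h15 := hypTr_fifteen_le_three hs hline hplane hsolid hflat5 hcard17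
  rcases Nat.lt_or_ge (hypTr M G 6 15) 2 with hlt | hge
  · exact jq_t6_nonneg_c10_q7_m0_two_level_h15le1 hs hline hplane hsolid hflat5 hflat6 hG hrG hcard hmG
      (by omega)
  · rcases Nat.lt_or_ge (hypTr M G 6 15) 3 with hlt3 | hge3
    · have h2 : hypTr M G 6 15 = 2 := by omega
      have h14 := hypTr_fourteen_le_one_of_two hs hline hplane hsolid hG hcard17 h2
      rcases Nat.lt_or_ge (hypTr M G 6 14) 1 with h0 | h1
      · exact jq_t6_nonneg_c10_q7_m0_two_level_h14_0_h15_2 hs hline hplane hsolid hflat5 hflat6 hG hrG hcard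
          hmG (by omega) h2
      · exact jq_t6_nonneg_c10_q7_m0_two_level_h14_1_h15_2 hs hline hplane hsolid hflat5 hflat6 hG hrG hcard
          hmG (by omega) h2
    · have h3 : hypTr M G 6 15 = 3 := by omega
      have h14 := hypTr_fourteen_eq_zero_of_three hs hline hplane hsolid hG hcard17 h3
      exact jq_t6_nonneg_c10_q7_m0_two_level_h14_0_h15_3 hs hline hplane hsolid hflat5 hflat6 hG hrG hcard hmG
        h14 h3

end PercRepro.Night4
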